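import Literature.MathematicalPhysics.QuantumFieldTheory.BalabanImbrieJaffe1984to88.BIJ88Eq5514Torus
import Literature.MathematicalPhysics.QuantumFieldTheory.BalabanImbrieJaffe1984to88.BIJ85Eq531Proof

/-!
# `BalabanImbrieJaffe1984to88.BIJ88Scaling313Background` — T. Bałaban, J. Imbrie, A. Jaffe, *Effective action and cluster properties of the
abelian Higgs model*, Commun. Math. Phys. **114** (1988) 257–315 [BalabanImbrieJaffe1988], p. 313 [PDF 57], the scaling of the background field
after the step, verbatim: *"Let us describe how the scaling affects a few of the objects that will be needed in the next step. Defining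
f^{(k+1)}(p) = (ie_{k+1})⁻¹ log v(p), we have that e_kηL⁻²𝒟^η_{k+1,loc}∂^{η*}Q^{e*}_{k+1}f = e_{k+1}L⁻¹η𝒟_{k+1,loc}∂^{L⁻¹η*}Q^{e*}_{k+1}f^{(k+1)},
and thus in Λ₆^{(k)*} we have u_{k+1,b} = (Q^{s*}v) exp[−ie_kL⁻¹η𝒟_{k+1,loc}∂^{L⁻¹η*}Q^{e*}_{k+1}f^{(k+1)}] as in the induction hypothesis (4.2)."*
(row `C2.Eq5.15.3`, *"scaling prose"*; (4.2) p. 274: *"u_k = (Q^{s*}_ku) exp(−ie_kη𝒟_{k,loc}∂*Q^{e*}_kf^{(k)}) … f^{(k)}(p) = (ie_k)⁻¹ log u(p)"*).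
PROVED as identities on the η-lattice carriers: the change of field-strength units `e_kf = e_{k+1}f^{(k+1)}` (r18's `fieldStrength`), the change
of the parameter of the co-divergence `∂^*` on plaquette functions, `∂^{L⁻¹η*} = L·∂^{η*}` (p30's `BIJ85Eq531Proof.plaqDiv`: `plaqDiv (Lη⁻¹)
= L•plaqDiv η⁻¹`), and — the one input that is a
convention about the scaled propagator — `𝒟_{k+1,loc}` on the `L⁻¹η`-lattice `= L⁻²·𝒟^η_{k+1,loc}` (the length² dimension of the Green's
functions; hypothesis `hD`), give the displayed identity and hence (5.6.1) on `Λ̄₆^{(k)*}` (this seat's gen-8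
`BIJ88Eq5514Torus.uTilde561_eq_backgroundU_of_mem`, r16's `uTilde561_of_theta_eq_one`) IS r18's (4.2) form `backgroundU e_{k+1} (L⁻¹η)
(Q^{s*}_{k+1}v) (𝒟_{k+1,loc}∂^{L⁻¹η*}Q^{e*}_{k+1}f^{(k+1)})` — the induction hypothesis at `k+1` with `η_{k+1} = L⁻¹η`.

READING NOTE (GAPS.md G-C2-18, filed with this proposal; owner r16 to rule).  The last display of the quoted passage prints the charge `e_k`
(«exp[−ie_kL⁻¹η𝒟_{k+1,loc}…f^{(k+1)}]»), but the identity printed on the line before it ends in `e_{k+1}L⁻¹η𝒟_{k+1,loc}∂^{L⁻¹η*}Q^{e*}_{k+1}f^{(k+1)}`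
and (4.2) at `k+1` carries `e_{k+1}`: the exponent of record is `−ie_{k+1}L⁻¹η𝒟_{k+1,loc}∂^{L⁻¹η*}Q^{e*}_{k+1}f^{(k+1)}` (`uTilde561_eq_backgroundU_scaled`
below), and the as-printed exponent differs from it by the factor `e_k/e_{k+1} = L^{(d−4)/2} ≠ 1` for `d < 4` ((2.2)) — a print slip (subscript),
nothing downstream uses the `e_k` form.

statement-level skeleton of published theorems with citation tags; proofs where landed; nothing here is a claim about the Yang–Mills mass gap

PDF held: `paper:balaban1988-cmp114-bij-abelian-higgs-effective-action` (journal page = PDF page + 256); p. 313 [PDF 57] rendered with the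
cell's `g4png.py` and read as an image this session (seat folder `pages/original-p057-x2.png`).

CITATION HEADER (lean-in-tree rule).  Part of the lit-balaban TYPED SKELETON (HOME `run/shared/lean/pub/lit-balaban/`), PHASE-2 proof seat p31
gen 9 (unit `lit-balaban-p31-g9`; fourth file of the gen; TAKING line HOME/STATUS.md).  WHAT IS REPRODUCED: rows `C2.Eq5.15.3` (scaling prose,
the two background-field displays of p. 313; owner r16) and `C2.Claim@313` (*"(4.2) at k+1"* clause), continuing gen-8 `BIJ88Eq5514Torus`
(p. 286 *"except for scaling, this reduces to the form in the induction hypothesis, (4.2)"*: `uTilde561_eq_backgroundU_of_mem`).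

WHAT IS PROVED (0 `sorry`, standard axioms; theorems only).
* §1 `fieldStrength_units` (`e·f_e(z) = e′·f_{e′}(z)`: *"Defining f^{(k+1)}(p) = (ie_{k+1})⁻¹ log v(p)"* ⟹ `e_kf = e_{k+1}f^{(k+1)}`), `plaqDiv_rescale`
  (`∂^{(Lc)*} = L·∂^{c*}` for p30's `plaqDiv`), `backgroundU_congr_exponent`.
* §2 **`scaling313`** — the displayed identity `e_kηL⁻²(𝒟^η X_f)(b) = e_{k+1}(L⁻¹η)(𝒟^{sc} X′)(b)`, `X_f = ∂^{η*}Q^{e*}f`, `X′ = ∂^{L⁻¹η*}Q^{e*}f^{(k+1)}`,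
  for linear `𝒟^η`, `Q^{e*}` and the scaled operator `𝒟^{sc} = L⁻²𝒟^η` (hypothesis `hD`), real coarse field strengths with `e_kf = e_{k+1}f^{(k+1)}`.
* §3 **`uTilde561_eq_backgroundU_scaled`** — on `Λ̄₆^{(k)*}` (first support clause of r16's `IsTheta561`), `ũ_{k+1}(b) = backgroundU e_{k+1} (L⁻¹η)
  Q (𝒟^{sc}X′)(b)`: (4.2) at `k+1` (abstract prefactor `Q = Q^{s*}_{k+1}v`); `uTilde561_eq_backgroundU_scaled_torus` (the concrete pull-back
  `qsstarGIter (k+1) v`).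
HONEST SCOPE.  The operators are abstract linear maps on the fixed η-lattice carrier (as in `BIJ88Eq5514Torus`); *"scaled to the L⁻¹η
lattice"* is therefore the hypothesis `hD : 𝒟^{sc}X = L⁻²𝒟^ηX` (what the displayed identity requires of the scaled propagator; for a
Green's function of a Laplacian with spacing parameter `c` it is the substitution `c ↦ Lc`), not a theorem about a concrete `𝒟_{k+1,loc}`; the
scaling of `ψ` and of the density ((5.15.3), p34's `BIJ88RTIterated.integral_scaleStep`) is not touched.  Imports: this seat's gen-8 `BIJ88Eq5514Torus`
(p299521) and p30's `BIJ85Eq531Proof` (`plaqDiv` = `∂^*` on plaquette functions).  Unit `lit-balaban-p31` (literature-prover-lit-balaban-p31-g9-0), 2026-08-21.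
NOT summit progress.
-/

namespace Literature.MathematicalPhysics.QuantumFieldTheory.BalabanImbrieJaffe1984to88.BIJ88Scaling313Background

open Literature.MathematicalPhysics.QuantumFieldTheory.Balaban1983to89
open BIJ88Sect3Statements (U1 toC fieldStrength)
open BIJ88Sect4Statements (backgroundU)
open BIJ88Sect5StatementsPart3 (uTilde561 IsTheta561 uTilde561_of_theta_eq_one)
open BIJ85Eq453GaugeField (qsstarGIter)
open BIJ85Eq531Proof (plaqDiv plaqDiv_smul)
open LatticeFieldCalculus (curl)
open Complex

noncomputable section

variable {P : Params} {n : ℕ}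

/-! ## §1  Units: `e_kf = e_{k+1}f^{(k+1)}`, `∂^{L⁻¹η*} = L∂^{η*}` (on plaquette functions) -/

/-- kernel: **«Defining f^{(k+1)}(p) = (ie_{k+1})⁻¹ log v(p)»** — the field strengths in the charges `e` and `e′` of the same plaquette value are
related by `e·f_e = e′·f_{e′}` (both equal `−i log v(p)`; r18's `fieldStrength e = (ie)⁻¹ log`, `e, e′ ≠ 0`).
[cite: BalabanImbrieJaffe1988, (5.15.3) p.313] -/
theorem fieldStrength_units {e e' : ℝ} (he : e ≠ 0) (he' : e' ≠ 0) (z : ℂ) :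
    (e : ℂ) * fieldStrength e z = (e' : ℂ) * fieldStrength e' z := by
  have h1 : (e : ℂ) ≠ 0 := ofReal_ne_zero.2 he
  have h2 : (e' : ℂ) ≠ 0 := ofReal_ne_zero.2 he'
  simp only [fieldStrength, mul_inv_rev]
  field_simp

/-- kernel: **`∂^{(Lc)*} = L·∂^{c*}`** — the co-divergence `∂^*` on plaquette functions (p30's `plaqDiv c`, the transpose of `curl c`) with the
spacing parameter of the `L⁻¹η`-lattice, `(L⁻¹η)⁻¹ = Lη⁻¹`, is `L` times the η-lattice one (both are `c`-homogeneous).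
[cite: BalabanImbrieJaffe1988, (5.15.3) p.313] -/
theorem plaqDiv_rescale (L c : ℝ) (F : Balaban1983to89.Plaq P n → ℝ) (b : PBond P n) :
    plaqDiv (L * c) F b = L * plaqDiv c F b := by
  simp only [plaqDiv, curl, smul_eq_mul, Finset.mul_sum]
  refine Finset.sum_congr rfl fun p _ => ?_
  ring

/-- kernel: r18's (4.2) form only depends on the exponent `e·ζ·g(b)` bond by bond. [cite: BalabanImbrieJaffe1988, (4.2) p.274] -/
theorem backgroundU_congr_exponent {e ζ e' ζ' : ℝ} {Q : PBond P n → ℂ} {g g' : PBond P n → ℝ} {b : PBond P n}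
    (h : e * ζ * g b = e' * ζ' * g' b) : backgroundU e ζ Q g b = backgroundU e' ζ' Q g' b := by
  simp only [backgroundU, h]

/-! ## §2  «e_kηL⁻²𝒟^η_{k+1,loc}∂^{η*}Q^{e*}_{k+1}f = e_{k+1}L⁻¹η𝒟_{k+1,loc}∂^{L⁻¹η*}Q^{e*}_{k+1}f^{(k+1)}» -/

/-- **The p. 313 scaling identity for the background-field exponent**, verbatim: *"e_kηL⁻²𝒟^η_{k+1,loc}∂^{η*}Q^{e*}_{k+1}f =
e_{k+1}L⁻¹η𝒟_{k+1,loc}∂^{L⁻¹η*}Q^{e*}_{k+1}f^{(k+1)}"* — bond by bond on the η-lattice carrier, for a linear `𝒟^η = 𝒟^η_{k+1,loc}`, the SCALED operator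
`𝒟^{sc} = 𝒟_{k+1,loc}` with `𝒟^{sc}X = L⁻²𝒟^ηX` (hypothesis `hD`), a linear `Q^{e*} = Q^{e*}_{k+1}` from real coarse plaquette functions, and real field
strengths `f`, `f′ = f^{(k+1)}` with `e_kf = e_{k+1}f^{(k+1)}` (`fieldStrength_units`); `∂^{η*} = plaqDiv η⁻¹`, `∂^{L⁻¹η*} = plaqDiv (Lη⁻¹)`
(`e_{k+1} ≠ 0`). [cite: BalabanImbrieJaffe1988, (5.15.3) p.313] -/
theorem scaling313 {β : Type*} {ek ek1 η L : ℝ} (hek1 : ek1 ≠ 0)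
    (Dη Dsc : (PBond P n → ℝ) →ₗ[ℝ] (PBond P n → ℝ)) (hD : ∀ X, Dsc X = L⁻¹ ^ 2 • Dη X)
    (Qe : (β → ℝ) →ₗ[ℝ] (Balaban1983to89.Plaq P n → ℝ)) {f f' : β → ℝ} (hf : ∀ p, ek * f p = ek1 * f' p) (b : PBond P n) :
    ek * η * (L⁻¹ ^ 2 * Dη (plaqDiv η⁻¹ (Qe f)) b) = ek1 * (L⁻¹ * η) * Dsc (plaqDiv (L * η⁻¹) (Qe f')) b := by
  have hf' : f' = (ek / ek1) • f := by
    funext p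
    simp only [Pi.smul_apply, smul_eq_mul]
    field_simp
    linarith [hf p]
  have hdiv : plaqDiv (L * η⁻¹) (Qe f') = (L * (ek / ek1)) • plaqDiv η⁻¹ (Qe f) := by
    funext x
    rw [Pi.smul_apply, smul_eq_mul, plaqDiv_rescale, hf', map_smul]
    rw [show ((ek / ek1) • Qe f : Balaban1983to89.Plaq P n → ℝ) = fun p => (ek / ek1) * Qe f p from rfl, plaqDiv_smul,
      Pi.smul_apply, smul_eq_mul]
    ring
  rw [hD, hdiv, map_smul, Pi.smul_apply, Pi.smul_apply, smul_eq_mul, smul_eq_mul]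
  field_simp

/-! ## §3  «and thus in Λ₆^{(k)*} we have u_{k+1,b} = (Q^{s*}v) exp[−ie_{k+1}L⁻¹η𝒟_{k+1,loc}∂^{L⁻¹η*}Q^{e*}_{k+1}f^{(k+1)}] as in (4.2)» -/

/-- **(4.2) AT `k+1`**: on `Λ̄₆^{(k)*}` (first support clause of r16's `IsTheta561 Λ̄₆* Λ̄₅* θ_k`) the new background field (5.6.1)
`ũ_{k+1} = (Q^{s*}_{k+1}v) exp ie_kη[(1−θ_k)H_{k,loc}A^{(k)} − L⁻²𝒟^η_{k+1,loc}X_f]` (r16's `uTilde561`, abstract prefactor `Q`, `X_f = ∂^{η*}Q^{e*}_{k+1}f`)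
IS r18's induction-hypothesis form (4.2) at `k+1`: `ũ_{k+1}(b) = (Q^{s*}_{k+1}v)(b)·exp(−ie_{k+1}(L⁻¹η)(𝒟_{k+1,loc}∂^{L⁻¹η*}Q^{e*}_{k+1}f^{(k+1)})(b))` —
`backgroundU e_{k+1} (L⁻¹η) Q (𝒟^{sc}X′)` — under the scaling hypothesis `hD` and `e_kf = e_{k+1}f^{(k+1)}` (reading of record for the charge:
`e_{k+1}`, see the READING NOTE). [cite: BalabanImbrieJaffe1988, (5.15.3) p.313] -/
theorem uTilde561_eq_backgroundU_scaled {β : Type*} {ek ek1 η L : ℝ} (hek1 : ek1 ≠ 0) (Q : PBond P n → ℂ)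
    {Λ6s Λ5s : Set (PBond P n)} {θ : PBond P n → ℝ} (hθ : IsTheta561 Λ6s Λ5s θ) (HA : PBond P n → ℝ)
    (Dη Dsc : (PBond P n → ℝ) →ₗ[ℝ] (PBond P n → ℝ)) (hD : ∀ X, Dsc X = L⁻¹ ^ 2 • Dη X)
    (Qe : (β → ℝ) →ₗ[ℝ] (Balaban1983to89.Plaq P n → ℝ)) {f f' : β → ℝ} (hf : ∀ p, ek * f p = ek1 * f' p) {b : PBond P n}
    (hb : b ∈ Λ6s) :
    uTilde561 ek η L Q θ HA (Dη (plaqDiv η⁻¹ (Qe f))) b =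
      backgroundU ek1 (L⁻¹ * η) Q (Dsc (plaqDiv (L * η⁻¹) (Qe f'))) b := by
  rw [uTilde561_of_theta_eq_one ek η L Q HA _ (hθ.1 b hb)]
  exact backgroundU_congr_exponent (scaling313 (η := η) hek1 Dη Dsc hD Qe hf b)

/-- **(4.2) at `k+1` on the torus**: the same with the concrete `(k+1)`-fold pull-back `Q^{s*}_{k+1}v = qsstarGIter (k+1) v` read in `ℂ` (the
prefactor of gen-8 `BIJ88Eq5514Torus.uTilde561_eq_backgroundU_of_mem`). [cite: BalabanImbrieJaffe1988, (5.15.3) p.313] -/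
theorem uTilde561_eq_backgroundU_scaled_torus {i k : ℕ} {β : Type*} {ek ek1 η L : ℝ} (hek1 : ek1 ≠ 0)
    (v : GaugeField P (i + k + 1) U1) {Λ6s Λ5s : Set (PBond P i)} {θ : PBond P i → ℝ} (hθ : IsTheta561 Λ6s Λ5s θ)
    (HA : PBond P i → ℝ) (Dη Dsc : (PBond P i → ℝ) →ₗ[ℝ] (PBond P i → ℝ)) (hD : ∀ X, Dsc X = L⁻¹ ^ 2 • Dη X)
    (Qe : (β → ℝ) →ₗ[ℝ] (Balaban1983to89.Plaq P i → ℝ)) {f f' : β → ℝ} (hf : ∀ p, ek * f p = ek1 * f' p) {b : PBond P i}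
    (hb : b ∈ Λ6s) :
    uTilde561 ek η L (fun b => toC (qsstarGIter (k + 1) v b)) θ HA (Dη (plaqDiv η⁻¹ (Qe f))) b =
      backgroundU ek1 (L⁻¹ * η) (fun b => toC (qsstarGIter (k + 1) v b)) (Dsc (plaqDiv (L * η⁻¹) (Qe f'))) b :=
  uTilde561_eq_backgroundU_scaled hek1 _ hθ HA Dη Dsc hD Qe hf hb

end

end Literature.MathematicalPhysics.QuantumFieldTheory.BalabanImbrieJaffe1984to88.BIJ88Scaling313Background
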